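import Literature.MathematicalPhysics.QuantumFieldTheory.Balaban1983to89.B8Ineq1141SectG

/-!
# `Balaban1983to89.B8Ineq1144ClassAk` — [Balaban1985RegularSpaces] Proposition 7 p. 100, the `𝔄_k`-clause of
# (1.144) «U′U₀ = (U₁U₀)^u ∈ 𝔄_k({Ω_j}, α₀ + 3α₂)» on the `ℤ^d` carriers of the lineage (`B8Ineq132.InAk`)

statement-level skeleton of published theorems with citation tags; proofs where landed; nothing here is a claim about the Yang–Mills mass gap

T. Bałaban, *Spaces of regular gauge field configurations on a lattice and gauge fixing conditions*, Commun.
Math. Phys. **99** (1985) 75–102 `[Balaban1985RegularSpaces]` ("B8"; printed page = PDF page + 74).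
PDF held: `paper:balaban1985-cmp99-regular-spaces-gauge-fixing` (lit store), pp. 77 and 100 read as text
(`p0003.txt`, `p0026.txt`).  STATUS: published, refereed; this file ASSEMBLES the first clause of (1.144) from
(1.141)/(1.142) (companion `B8Ineq1141SectG`) and the gauge invariance / level monotonicity of `𝔄_k`
(`B8Ineq132`) — nothing here is new mathematics or a claim about the Clay problem.

WHAT IS REPRODUCED (lit-balaban SKELETON rows): **B8.Prop7** — the FIRST CLAUSE of display (1.144),
«U′U₀ = (U₁U₀)^u ∈ 𝔄_k({Ω_j}, α₀ + 3α₂)», on the `𝔄_k` of record `B8Ineq132.InAk` / `B8Ineq132.CondAt` (row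
B8.Eq1.7), together with print's simplification sentence «α₀ + 2α₂ + 8α₂² ≦ α₀ + 3α₂, α₀ + α₂ + 36dα₂² + 50dα₂³ +
10dα₀α₂ ≦ α₀ + 2α₂» with EXPLICIT thresholds.  The `Ax_k`-clause of (1.144) and (1.145) are NOT touched ((1.145) is
the owner's `B8Ineq145*` lane).  Unit `lit-balaban-p40` (Phase-2 proof seat p40, gen 4), HOME
`run/shared/lean/pub/lit-balaban/` (SKELETON.md row B8.Prop7; owner fold `lit-balaban-r05/ROWS-B8.md`).

## THE PRINTED TEXT (p. 100 [PDF 26], quoted from the text layer; p. 77 for 𝔄_k)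

«To simplify formulations we assume that α₀, α₂ are so small that α₀ + 2α₂ + 8α₂² ≦ α₀ + 3α₂,
α₀ + α₂ + 36dα₂² + 50dα₂³ + 10dα₀α₂ ≦ α₀ + 2α₂. … Let us take a gauge transformation u satisfying the conditions
(1.29) and such that the configuration U′ = (U₁U₀)^u U₀⁻¹ satisfies the axial gauge conditions (1.19). This gauge
transformation is determined uniquely. The above bounds imply the following
Proposition 7. If the configurations U₀, A satisfy (1.139), (1.140), then for α₀, α₂ sufficiently small we have
U′U₀ = (U₁U₀)^u ∈ 𝔄_k({Ω_j}, α₀ + 3α₂) ∩ Ax_k(𝔅_k, U₀), (1.144) …»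
(p. 77: (1.7) «|U(∂p) − 1| < α₀L^{−2j} for p ∈ Ω_j», (1.9) «|(D^{η*}_U ∂U)(b)| < α₀L^{−2j}(Lʲη)⁻¹ for b ∈ Ω_j»,
`j ≤ k`; «if these conditions hold for some j = l, then they hold for all j < l»; «Thus the space 𝔄_k({Ω_j}, α₀)
is invariant [under gauge transformations]»; «we admit the case where … Ω_j = T_η for j = 0, 1, …, l, l ≦ k».)

## WHAT IS CERTIFIED HERE (kernel; axioms `propext` / `Classical.choice` / `Quot.sound`)

Carriers and dictionary as in `B8Ineq1141SectG`; `𝔄_k({Ω_j}, α₀) = B8Ineq132.InAk`, one level on one set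
`B8Ineq132.CondAt`:
* §0 the simplification sentence as arithmetic (`plaq_slack_le`, `bond_slack_le`).
* §1 the two clauses with `α₀ + 3α₂` at one plaquette / one bond: `ineq1141_lt` — for `0 ≤ α₀ ≤ 1/8`,
  `0 ≤ α₂ ≤ 1/20`, `L ≥ 1` and `|U₀(∂p) − 1| < α₀L^{−2j}` STRICT, `|(U₁U₀)(∂p) − 1| < (α₀ + 3α₂)L^{−2j}`;
  `ineq1142_lt` — for `0 ≤ α₀, α₂ ≤ 1/(80d)`, `L ≥ 1` and (1.9) for `U₀` STRICT,
  `|D^{η*}_{U₁U₀}∂(U₁U₀)(b)| < (α₀ + 2α₂)L^{−2j}(Lʲη)⁻¹` (hence `< (α₀ + 3α₂)…`).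
* §2 **(1.144), the `𝔄_k`-clause**: `condAt_mulCfg` — the level-`j` conditions (1.7)/(1.9) of `U₁U₀` with
  `α₀ + 3α₂` on EVERY site set `S`, from (1.139)/(1.140) at level `j` in the GLOBAL reading (below) and
  `0 ≤ α₀, α₂ ≤ 1/(80d)`; `inAk_mulCfg` — **`U₁U₀ ∈ 𝔄_k({Ω_j}, α₀ + 3α₂)` for every family `{Ω_j}`** from the
  level-`k` hypotheses (p. 77 monotonicity, `B8Ineq132.condAt_mono`); `inAk_mulCfg_gaugeAct` —
  **`(U₁U₀)^u ∈ 𝔄_k({Ω_j}, α₀ + 3α₂)` for EVERY gauge transformation `u`** with values in `U1` (p. 77 gauge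
  invariance, `B8Ineq132.inAk_gaugeAct_iff`), in particular for print's axial `u` of (1.29)/(1.19);
  `inAk_mulCfg_of_inAk_univ` — the same with (1.139) entered LITERALLY as `U₀ ∈ 𝔄_k({T_η, …, T_η}, α₀)` (print's
  admitted case `Ω_j = T_η`, `j ≤ k`).
* §3 the HERMITIAN case (`𝔸` a C⋆-algebra, `A(b)` self-adjoint, `U₀` with values in `U1 ⊇` the unitaries): the two
  standing hypotheses on `U₁ = e^{iηA}` (`U₁ ∈ U1`, `|U₁ − 1| ≤ α₂(Lʲη)⁻¹η`) DISCHARGED (`B8Eq155JBound`):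
  `inAk_mulCfg_hermitian`, `inAk_mulCfg_gaugeAct_hermitian`, and the `∃ c > 0` sentence shape of the row's abstract
  leaf `B8SectGH.Prop7PrintedR` restricted to its `𝔄_k`-clause: **`prop7_classAk`** (`c = 1/(80d)`).

## DICTIONARY / HONEST SCOPE — what is NOT claimed

(i) GLOBAL READING.  The parents' (1.43)–(1.55) certificates take their smallness hypotheses on ALL bonds /
plaquettes of `ℤ^d` at one level (`B8Eq143PlaqExpansion` HONEST SCOPE (ii)); accordingly (1.139)/(1.140) enter at
ONE level on the whole lattice: `|U₀(∂p) − 1| < α₀L^{−2j}` and `|D^{η*}_{U₀}∂U₀(b)| < α₀L^{−2j}(Lʲη)⁻¹` everywhere,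
`|A| ≤ α₂(Lʲη)⁻¹`, `|∇^η_{U₀}A| ≤ α₂(Lʲη)⁻²`, `|D^{η*}_{U₀}D^η_{U₀}A| ≤ α₂(Lʲη)⁻³` everywhere — exactly print's
admitted case «Ω_j = T_η for j = 0, 1, …, l» at `l = k` (the strongest level), from which the membership in
`𝔄_k({Ω_j}, α₀ + 3α₂)` follows for EVERY family `{Ω_j}`.  The localisation of (1.139)/(1.140) to a general
admissible family (1.3)/(1.4) — hypotheses level by level «on Ω_j» only — is NOT reproduced (it would need local
versions of the parents' (1.54)).
(ii) «α₀, α₂ sufficiently small» ↦ the explicit thresholds `α₀ ≤ 1/8, α₂ ≤ 1/20` (plaquettes) and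
`α₀, α₂ ≤ 1/(80d)` (bonds; the printed constants `36d, 50d, 10d` force a `d`-dependence); `c = 1/(80d)` in
`prop7_classAk`.  The final `<` of (1.7)/(1.9) for `U₁U₀` comes from the strict (1.7)/(1.9) for `U₀`.
(iii) The `Ax_k(𝔅_k, U₀)`-clause of (1.144) (existence/uniqueness of the axial `u`, row B8.Eq1.19) and (1.145) are
not in this file; since `𝔄_k` is gauge invariant the `𝔄_k`-clause holds for `(U₁U₀)^u` with ANY `U1`-valued `u`,
which is what `inAk_mulCfg_gaugeAct` states.  The abstract leaf `B8SectGH.Prop7PrintedR` (carriers `GFData3`) is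
not instantiated.
(iv) `T_η` ↦ `ℤ^d`, spacing `η > 0` explicit; `L^{−2j}` written `α(((L:ℝ)^j)⁻¹)²` as in `B8Ineq132.CondAt`.
-/

noncomputable section

open scoped BigOperators
open NormedSpace Finset

namespace Literature.MathematicalPhysics.QuantumFieldTheory.Balaban1983to89.B8Ineq1144ClassAk

open B7Prop1Explicit
open B8Lemma1NonAbelian (mulCfg)
open B8Ineq132 (plaqF covDeriv covDerivFwd covDiv CondAt InAk PlaqTouches BondTouches condAt_mono
  inAk_gaugeAct_iff)
open B8Eq143PlaqExpansion (pdiv)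
open B8Eq146AExpansion (expCfg iEta plaqCovDeriv)
open B8Ineq1141SectG (inv_mul_eta_le_one eta_sq_mul_inv_sq eta_sq_mul_inv_cube ineq1141 ineq1142_pointwise)

-- `Site` alone would resolve to the torus sites of `Setup.lean`; re-export the `ℤ^d` sites of `B7Prop1Explicit`.
export B7Prop1Explicit (Site)

variable {d : ℕ}

/-! ## §0. The simplification sentence as arithmetic -/

section Arith

/-- «α₀ + 2α₂ + 8α₂² ≦ α₀ + 3α₂» with the cross terms: for `0 ≤ α₀ ≤ 1/8`, `0 ≤ α₂ ≤ 1/20`, `0 ≤ t ≤ 1`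
(`t = L^{−j}`): `4α₀α₂t + 8α₂²(1 + (16/9)α₂t) ≤ α₂`. [cite: Balaban1985RegularSpaces, p.100 (sentence after (1.142))] -/
theorem plaq_slack_le {α₀ α₂ t : ℝ} (hα₀ : 0 ≤ α₀) (hα₀c : α₀ ≤ 1 / 8) (hα₂ : 0 ≤ α₂) (hα₂c : α₂ ≤ 1 / 20)
    (ht : 0 ≤ t) (ht1 : t ≤ 1) :
    4 * α₀ * α₂ * t + 8 * α₂ ^ 2 * (1 + 16 / 9 * (α₂ * t)) ≤ α₂ := by
  have h02 : 0 ≤ α₂ * t := mul_nonneg hα₂ ht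
  have h002 : 0 ≤ α₀ * α₂ := mul_nonneg hα₀ hα₂
  have h1 : 4 * α₀ * α₂ * t ≤ α₂ / 2 := by nlinarith [mul_nonneg h002 ht]
  have h2 : α₂ * t ≤ 1 / 20 := by nlinarith
  have h3 : 8 * α₂ ^ 2 * (1 + 16 / 9 * (α₂ * t)) ≤ α₂ / 2 := by nlinarith [sq_nonneg α₂]
  linarith

/-- «α₀ + α₂ + 36dα₂² + 50dα₂³ + 10dα₀α₂ ≦ α₀ + 2α₂»: for `α₀ ≤ 1/(80d)`, `0 ≤ α₂ ≤ 1/(80d)`, `d ≥ 1`: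
`36dα₂² + 50dα₂³ + 10dα₀α₂ ≤ α₂`. [cite: Balaban1985RegularSpaces, p.100 (sentence after (1.142))] -/
theorem bond_slack_le (hd : 1 ≤ d) {α₀ α₂ : ℝ} (hα₀c : α₀ ≤ 1 / (80 * d)) (hα₂ : 0 ≤ α₂)
    (hα₂c : α₂ ≤ 1 / (80 * d)) :
    36 * d * α₂ ^ 2 + 50 * d * α₂ ^ 3 + 10 * d * α₀ * α₂ ≤ α₂ := by
  have hd1 : (1 : ℝ) ≤ d := by exact_mod_cast hd
  have hd0 : (0 : ℝ) < 80 * d := by positivity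
  have hda₂ : (d : ℝ) * α₂ ≤ 1 / 80 := by
    rw [le_div_iff₀ hd0] at hα₂c; nlinarith
  have hda₀ : (d : ℝ) * α₀ ≤ 1 / 80 := by
    rw [le_div_iff₀ hd0] at hα₀c; nlinarith
  have hα₂1 : α₂ ≤ 1 / 80 := hα₂c.trans (one_div_le_one_div_of_le (by norm_num) (by linarith))
  have h1 : 36 * d * α₂ ^ 2 ≤ 36 / 80 * α₂ := by nlinarith
  have h2 : 50 * d * α₂ ^ 3 ≤ 50 / 80 / 80 * α₂ := by nlinarith [mul_nonneg hα₂ hα₂, sq_nonneg α₂]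
  have h3 : 10 * d * α₀ * α₂ ≤ 10 / 80 * α₂ := by nlinarith
  nlinarith

end Arith

/-! ## §1. The two clauses of `𝔄_k` with `α₀ + 3α₂` at one plaquette / one bond -/

section Clauses

variable {𝔸 : Type*} [NormedRing 𝔸] [NormOneClass 𝔸] [NormedAlgebra ℂ 𝔸] [CompleteSpace 𝔸]

/-- **«α₀ + 2α₂ + 8α₂² ≦ α₀ + 3α₂»: the plaquette clause (1.7) of (1.144) at level `j`.**  Under the hypotheses of
`ineq1141` with `α₂ ≤ 1/20`, `0 ≤ α₀ ≤ 1/8`, `L ≥ 1`, and the STRICT (1.139) `|U₀(∂p) − 1| < α₀L^{−2j}` at the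
plaquette: `|(U₁U₀)(∂p) − 1| < (α₀ + 3α₂)L^{−2j}`. [cite: Balaban1985RegularSpaces, (1.144) p.100 (with (1.7) p.77)] -/
theorem ineq1141_lt {η : ℝ} (hη : 0 < η) {U₀ : Site d → Fin d → 𝔸ˣ} (h₀ : ∀ y κ, U₀ y κ ∈ U1 𝔸)
    {A : Site d → Fin d → 𝔸} (h₁ : ∀ y κ, expCfg (iEta η A) y κ ∈ U1 𝔸) {L : ℕ} (hL : 1 ≤ L) {j : ℕ}
    {α₀ α₂ : ℝ} (hα₀ : 0 ≤ α₀) (hα₀c : α₀ ≤ 1 / 8) (hα₂ : 0 ≤ α₂) (hα₂c : α₂ ≤ 1 / 20)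
    (hu : ∀ y κ, ‖(expCfg (iEta η A) y κ : 𝔸) - 1‖ ≤ α₂ * ((L : ℝ) ^ j * η)⁻¹ * η)
    (hA : ∀ y κ, ‖A y κ‖ ≤ α₂ * ((L : ℝ) ^ j * η)⁻¹)
    (hG : ∀ (y : Site d) (κ τ : Fin d), ‖covDerivFwd η U₀ κ (fun z => A z τ) y‖ ≤ α₂ * (((L : ℝ) ^ j * η)⁻¹) ^ 2)
    {μ ν : Fin d} {x : Site d} (hp : ‖plaqF U₀ μ ν x - 1‖ < α₀ * (((L : ℝ) ^ j)⁻¹) ^ 2) :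
    ‖plaqF (mulCfg (expCfg (iEta η A)) U₀) μ ν x - 1‖ < (α₀ + 3 * α₂) * (((L : ℝ) ^ j)⁻¹) ^ 2 := by
  set r : ℝ := ((L : ℝ) ^ j * η)⁻¹ with hr_def
  have hr : 0 < r := inv_pos.mpr (by positivity)
  have ht1 : r * η ≤ 1 := inv_mul_eta_le_one hL hη j
  have ht0 : 0 ≤ r * η := by positivity
  have hunits : η ^ 2 * r ^ 2 = (((L : ℝ) ^ j)⁻¹) ^ 2 := eta_sq_mul_inv_sq hη.ne' j
  have ha : α₂ * r * η ≤ 1 / 20 := by nlinarith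
  have hsmall : 4 * (α₂ * r * η) ≤ 1 := by linarith
  have h := ineq1141 hη h₀ h₁ hα₂ hu hA hG hsmall μ ν x
  rw [← hunits] at hp ⊢
  have h1 : (1 + 4 * (α₂ * r * η)) * ‖plaqF U₀ μ ν x - 1‖ < (1 + 4 * (α₂ * r * η)) * (α₀ * (η ^ 2 * r ^ 2)) :=
    mul_lt_mul_of_pos_left hp (by positivity)
  have hslack := plaq_slack_le hα₀ hα₀c hα₂ hα₂c ht0 ht1
  calc ‖plaqF (mulCfg (expCfg (iEta η A)) U₀) μ ν x - 1‖
      < (1 + 4 * (α₂ * r * η)) * (α₀ * (η ^ 2 * r ^ 2)) +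
          (2 * α₂ + 8 * α₂ ^ 2 * (1 + 16 / 9 * (α₂ * r * η))) * (η ^ 2 * r ^ 2) := by linarith
    _ = (α₀ + 2 * α₂ + (4 * α₀ * α₂ * (r * η) + 8 * α₂ ^ 2 * (1 + 16 / 9 * (α₂ * (r * η))))) *
          (η ^ 2 * r ^ 2) := by ring
    _ ≤ (α₀ + 2 * α₂ + α₂) * (η ^ 2 * r ^ 2) := by gcongr
    _ = (α₀ + 3 * α₂) * (η ^ 2 * r ^ 2) := by ring

/-- **«α₀ + α₂ + 36dα₂² + 50dα₂³ + 10dα₀α₂ ≦ α₀ + 2α₂»: the bond clause (1.9) of (1.144) at level `j`.**  Under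
the hypotheses of `ineq1142` except that (1.9) for `U₀` at the bond is STRICT and in the units of
`B8Ineq132.CondAt` (`|D^{η*}_{U₀}∂U₀(b)| < α₀L^{−2j}(Lʲη)⁻¹`), with `0 ≤ α₀, α₂ ≤ 1/(80d)`, `L ≥ 1`:
`|D^{η*}_{U₁U₀}∂(U₁U₀)(b)| < (α₀ + 2α₂)L^{−2j}(Lʲη)⁻¹` (hence `< (α₀ + 3α₂)L^{−2j}(Lʲη)⁻¹`).
[cite: Balaban1985RegularSpaces, (1.144) p.100 (with (1.9) p.77)] -/
theorem ineq1142_lt {η : ℝ} (hη : 0 < η) {U₀ : Site d → Fin d → 𝔸ˣ} (h₀ : ∀ y κ, U₀ y κ ∈ U1 𝔸)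
    {A : Site d → Fin d → 𝔸} (h₁ : ∀ y κ, expCfg (iEta η A) y κ ∈ U1 𝔸) {L : ℕ} (hL : 1 ≤ L) {j : ℕ}
    {α₀ α₂ : ℝ} (hα₀ : 0 ≤ α₀) (hα₀c : α₀ ≤ 1 / (80 * d)) (hα₂ : 0 ≤ α₂) (hα₂c : α₂ ≤ 1 / (80 * d))
    (hA : ∀ y κ, ‖A y κ‖ ≤ α₂ * ((L : ℝ) ^ j * η)⁻¹)
    (hG : ∀ (y : Site d) (κ τ : Fin d), ‖covDerivFwd η U₀ κ (fun z => A z τ) y‖ ≤ α₂ * (((L : ℝ) ^ j * η)⁻¹) ^ 2)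
    (hu : ∀ y κ, ‖(expCfg (iEta η A) y κ : 𝔸) - 1‖ ≤ α₂ * ((L : ℝ) ^ j * η)⁻¹ * η)
    (hp : ∀ (y : Site d) (κ ν : Fin d), κ ≠ ν → ‖plaqF U₀ κ ν y - 1‖ ≤ α₀ * η ^ 2 * (((L : ℝ) ^ j * η)⁻¹) ^ 2)
    {μ : Fin d} {x : Site d}
    (h9 : ‖covDiv η U₀ μ x‖ < α₀ * (((L : ℝ) ^ j)⁻¹) ^ 2 * ((L : ℝ) ^ j * η)⁻¹)
    (hDDA : ‖pdiv η U₀ (plaqCovDeriv η U₀ A) μ x‖ ≤ α₂ * (((L : ℝ) ^ j * η)⁻¹) ^ 3) :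
    ‖covDiv η (mulCfg (expCfg (iEta η A)) U₀) μ x‖ <
      (α₀ + 2 * α₂) * ((((L : ℝ) ^ j)⁻¹) ^ 2 * ((L : ℝ) ^ j * η)⁻¹) := by
  have hd1 : 1 ≤ d := Fin.pos μ
  have hd1' : (1 : ℝ) ≤ d := by exact_mod_cast hd1
  set r : ℝ := ((L : ℝ) ^ j * η)⁻¹ with hr_def
  have hr : 0 < r := inv_pos.mpr (by positivity)
  have ht1 : r * η ≤ 1 := inv_mul_eta_le_one hL hη j
  have hunits : η ^ 2 * r ^ 3 = (((L : ℝ) ^ j)⁻¹) ^ 2 * r := eta_sq_mul_inv_cube hη.ne' j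
  have h80 : (0 : ℝ) < 80 * d := by positivity
  have hα₂80 : α₂ ≤ 1 / 80 := hα₂c.trans (one_div_le_one_div_of_le (by norm_num) (by linarith))
  have hdα₂ : (d : ℝ) * α₂ ≤ 1 / 80 := by
    have := hα₂c; rw [le_div_iff₀ h80] at this; nlinarith
  have ha : α₂ * r * η ≤ α₂ := by nlinarith
  have hsmall : 16 * (α₂ * r * η) ≤ 1 := by nlinarith
  have hd' : 5 * (α₂ * r * η) * ((d : ℝ) - 1) ≤ 4 := by
    have : 0 ≤ (d : ℝ) - 1 := by linarith
    have h1 : 5 * (α₂ * r * η) * ((d : ℝ) - 1) ≤ 5 * α₂ * ((d : ℝ) - 1) := by nlinarith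
    nlinarith
  have h := ineq1142_pointwise hη h₀ h₁ hα₀ hα₂ hA hG hu hp hsmall hd' μ x
  have h9' : ‖covDiv η U₀ μ x‖ < α₀ * (η ^ 2 * r ^ 3) := by rw [hunits, ← mul_assoc]; exact h9
  rw [← hunits]
  have h2 : η ^ 2 * ‖pdiv η U₀ (plaqCovDeriv η U₀ A) μ x‖ ≤ η ^ 2 * (α₂ * r ^ 3) :=
    mul_le_mul_of_nonneg_left hDDA (sq_nonneg η)
  have hslack := bond_slack_le hd1 hα₀c hα₂ hα₂c
  calc ‖covDiv η (mulCfg (expCfg (iEta η A)) U₀) μ x‖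
      < α₀ * (η ^ 2 * r ^ 3) + η ^ 2 * (α₂ * r ^ 3) +
          (36 * d * (α₂ * r) * (α₂ * r ^ 2) * η ^ 2 + 50 * d * α₂ ^ 3 * r ^ 3 * η ^ 2 +
            10 * d * α₀ * α₂ * r ^ 3 * η ^ 2) := by linarith
    _ = (α₀ + α₂ + (36 * d * α₂ ^ 2 + 50 * d * α₂ ^ 3 + 10 * d * α₀ * α₂)) * (η ^ 2 * r ^ 3) := by ring
    _ ≤ (α₀ + α₂ + α₂) * (η ^ 2 * r ^ 3) := by gcongr
    _ = (α₀ + 2 * α₂) * (η ^ 2 * r ^ 3) := by ring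

end Clauses

/-! ## §2. (1.144): `U₁U₀ ∈ 𝔄_k({Ω_j}, α₀ + 3α₂)` and `(U₁U₀)^u ∈ 𝔄_k({Ω_j}, α₀ + 3α₂)` -/

section ClassAk

variable {𝔸 : Type*} [NormedRing 𝔸] [NormOneClass 𝔸] [NormedAlgebra ℂ 𝔸] [CompleteSpace 𝔸]

/-- **(1.144), `𝔄`-clause at one level `j` on one set `S`.**  For `U1`-valued `U₀` and `U₁ = e^{iηA}` `U1`-valued
with `|U₁ − 1| ≤ α₂(Lʲη)⁻¹η`, `η > 0`, `L ≥ 1`, `0 ≤ α₀, α₂ ≤ 1/(80d)`, under (1.139) at level `j` read on the whole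
lattice (`|U₀(∂p) − 1| < α₀L^{−2j}` all `p`, `|D^{η*}_{U₀}∂U₀(b)| < α₀L^{−2j}(Lʲη)⁻¹` all `b`) and the three members
of (1.140) at level `j` on all bonds: the conditions (1.7), (1.9) with `α₀ + 3α₂` hold for `U₁U₀` at level `j` on
EVERY site set `S`. [cite: Balaban1985RegularSpaces, (1.144) p.100] -/
theorem condAt_mulCfg {η : ℝ} (hη : 0 < η) {L : ℕ} (hL : 1 ≤ L) (j : ℕ) {U₀ : Site d → Fin d → 𝔸ˣ}
    (h₀ : ∀ y κ, U₀ y κ ∈ U1 𝔸) {A : Site d → Fin d → 𝔸} (h₁ : ∀ y κ, expCfg (iEta η A) y κ ∈ U1 𝔸)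
    {α₀ α₂ : ℝ} (hα₀ : 0 ≤ α₀) (hα₀c : α₀ ≤ 1 / (80 * d)) (hα₂ : 0 ≤ α₂) (hα₂c : α₂ ≤ 1 / (80 * d))
    (hu : ∀ y κ, ‖(expCfg (iEta η A) y κ : 𝔸) - 1‖ ≤ α₂ * ((L : ℝ) ^ j * η)⁻¹ * η)
    (h7 : ∀ (y : Site d) (κ ν : Fin d), κ ≠ ν → ‖plaqF U₀ κ ν y - 1‖ < α₀ * (((L : ℝ) ^ j)⁻¹) ^ 2)
    (h9 : ∀ (y : Site d) (κ : Fin d), ‖covDiv η U₀ κ y‖ < α₀ * (((L : ℝ) ^ j)⁻¹) ^ 2 * ((L : ℝ) ^ j * η)⁻¹)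
    (hA : ∀ y κ, ‖A y κ‖ ≤ α₂ * ((L : ℝ) ^ j * η)⁻¹)
    (hG : ∀ (y : Site d) (κ τ : Fin d), ‖covDerivFwd η U₀ κ (fun z => A z τ) y‖ ≤ α₂ * (((L : ℝ) ^ j * η)⁻¹) ^ 2)
    (hDDA : ∀ (y : Site d) (κ : Fin d), ‖pdiv η U₀ (plaqCovDeriv η U₀ A) κ y‖ ≤ α₂ * (((L : ℝ) ^ j * η)⁻¹) ^ 3)
    (S : Set (Site d)) : CondAt L η (α₀ + 3 * α₂) j S (mulCfg (expCfg (iEta η A)) U₀) := by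
  constructor
  · intro x μ ν hμν _hp
    have hd1 : 1 ≤ d := Fin.pos μ
    have hd1' : (1 : ℝ) ≤ d := by exact_mod_cast hd1
    have hα₀c' : α₀ ≤ 1 / 8 := hα₀c.trans (one_div_le_one_div_of_le (by norm_num) (by linarith))
    have hα₂c' : α₂ ≤ 1 / 20 := hα₂c.trans (one_div_le_one_div_of_le (by norm_num) (by linarith))
    exact ineq1141_lt hη h₀ h₁ hL hα₀ hα₀c' hα₂ hα₂c' hu hA hG (h7 x μ ν hμν)
  · intro x μ _hb
    have hp : ∀ (y : Site d) (κ ν : Fin d), κ ≠ ν →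
        ‖plaqF U₀ κ ν y - 1‖ ≤ α₀ * η ^ 2 * (((L : ℝ) ^ j * η)⁻¹) ^ 2 := by
      intro y κ ν hκν
      have h := (h7 y κ ν hκν).le
      rwa [← eta_sq_mul_inv_sq (L := L) hη.ne' j, ← mul_assoc] at h
    have h := ineq1142_lt hη h₀ h₁ hL hα₀ hα₀c hα₂ hα₂c hA hG hu hp (h9 x μ) (hDDA x μ)
    refine h.trans_le ?_
    have : 0 ≤ (((L : ℝ) ^ j)⁻¹) ^ 2 * ((L : ℝ) ^ j * η)⁻¹ := by positivity
    rw [mul_assoc]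
    gcongr
    linarith

/-- **(1.144), `𝔄_k`-clause: `U₁U₀ ∈ 𝔄_k({Ω_j}, α₀ + 3α₂)` for EVERY family `{Ω_j}_{j ≤ k}`**, from (1.139)/(1.140)
at the top level `k` read on the whole lattice (print's admitted case «Ω_j = T_η», p. 77) and `0 ≤ α₀, α₂ ≤
1/(80d)`: the level-`k` conditions imply the level-`j` ones for `j ≤ k` («if these conditions hold for some j = l,
then they hold for all j < l», p. 77). [cite: Balaban1985RegularSpaces, Prop. 7 (1.144) p.100] -/
theorem inAk_mulCfg {η : ℝ} (hη : 0 < η) {L : ℕ} (hL : 1 ≤ L) (k : ℕ) {U₀ : Site d → Fin d → 𝔸ˣ}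
    (h₀ : ∀ y κ, U₀ y κ ∈ U1 𝔸) {A : Site d → Fin d → 𝔸} (h₁ : ∀ y κ, expCfg (iEta η A) y κ ∈ U1 𝔸)
    {α₀ α₂ : ℝ} (hα₀ : 0 ≤ α₀) (hα₀c : α₀ ≤ 1 / (80 * d)) (hα₂ : 0 ≤ α₂) (hα₂c : α₂ ≤ 1 / (80 * d))
    (hu : ∀ y κ, ‖(expCfg (iEta η A) y κ : 𝔸) - 1‖ ≤ α₂ * ((L : ℝ) ^ k * η)⁻¹ * η)
    (h7 : ∀ (y : Site d) (κ ν : Fin d), κ ≠ ν → ‖plaqF U₀ κ ν y - 1‖ < α₀ * (((L : ℝ) ^ k)⁻¹) ^ 2)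
    (h9 : ∀ (y : Site d) (κ : Fin d), ‖covDiv η U₀ κ y‖ < α₀ * (((L : ℝ) ^ k)⁻¹) ^ 2 * ((L : ℝ) ^ k * η)⁻¹)
    (hA : ∀ y κ, ‖A y κ‖ ≤ α₂ * ((L : ℝ) ^ k * η)⁻¹)
    (hG : ∀ (y : Site d) (κ τ : Fin d), ‖covDerivFwd η U₀ κ (fun z => A z τ) y‖ ≤ α₂ * (((L : ℝ) ^ k * η)⁻¹) ^ 2)
    (hDDA : ∀ (y : Site d) (κ : Fin d), ‖pdiv η U₀ (plaqCovDeriv η U₀ A) κ y‖ ≤ α₂ * (((L : ℝ) ^ k * η)⁻¹) ^ 3)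
    (Ω : ℕ → Set (Site d)) : InAk L k η (α₀ + 3 * α₂) Ω (mulCfg (expCfg (iEta η A)) U₀) :=
  fun _j hjk => condAt_mono hL (by positivity) hη hjk
    (condAt_mulCfg hη hL k h₀ h₁ hα₀ hα₀c hα₂ hα₂c hu h7 h9 hA hG hDDA _)

omit [CompleteSpace 𝔸] in
/-- **(1.144): `U′U₀ = (U₁U₀)^u ∈ 𝔄_k({Ω_j}, α₀ + 3α₂)` for EVERY gauge transformation `u`** with values in
`{|u| ≤ 1, |u⁻¹| ≤ 1}` — in particular for print's `u` of (1.29)/(1.19) — by the gauge invariance of `𝔄_k` (p. 77,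
`B8Ineq132.inAk_gaugeAct_iff`) and `inAk_mulCfg`. [cite: Balaban1985RegularSpaces, Prop. 7 (1.144) p.100] -/
theorem inAk_mulCfg_gaugeAct [CompleteSpace 𝔸] {η : ℝ} (hη : 0 < η) {L : ℕ} (hL : 1 ≤ L) (k : ℕ)
    {U₀ : Site d → Fin d → 𝔸ˣ} (h₀ : ∀ y κ, U₀ y κ ∈ U1 𝔸) {A : Site d → Fin d → 𝔸}
    (h₁ : ∀ y κ, expCfg (iEta η A) y κ ∈ U1 𝔸) {α₀ α₂ : ℝ} (hα₀ : 0 ≤ α₀) (hα₀c : α₀ ≤ 1 / (80 * d))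
    (hα₂ : 0 ≤ α₂) (hα₂c : α₂ ≤ 1 / (80 * d))
    (hu : ∀ y κ, ‖(expCfg (iEta η A) y κ : 𝔸) - 1‖ ≤ α₂ * ((L : ℝ) ^ k * η)⁻¹ * η)
    (h7 : ∀ (y : Site d) (κ ν : Fin d), κ ≠ ν → ‖plaqF U₀ κ ν y - 1‖ < α₀ * (((L : ℝ) ^ k)⁻¹) ^ 2)
    (h9 : ∀ (y : Site d) (κ : Fin d), ‖covDiv η U₀ κ y‖ < α₀ * (((L : ℝ) ^ k)⁻¹) ^ 2 * ((L : ℝ) ^ k * η)⁻¹)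
    (hA : ∀ y κ, ‖A y κ‖ ≤ α₂ * ((L : ℝ) ^ k * η)⁻¹)
    (hG : ∀ (y : Site d) (κ τ : Fin d), ‖covDerivFwd η U₀ κ (fun z => A z τ) y‖ ≤ α₂ * (((L : ℝ) ^ k * η)⁻¹) ^ 2)
    (hDDA : ∀ (y : Site d) (κ : Fin d), ‖pdiv η U₀ (plaqCovDeriv η U₀ A) κ y‖ ≤ α₂ * (((L : ℝ) ^ k * η)⁻¹) ^ 3)
    (Ω : ℕ → Set (Site d)) {u : Site d → 𝔸ˣ} (hu1 : ∀ x, u x ∈ U1 𝔸) :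
    InAk L k η (α₀ + 3 * α₂) Ω (gaugeAct u (mulCfg (expCfg (iEta η A)) U₀)) :=
  (inAk_gaugeAct_iff L k η _ Ω hu1 _).2 (inAk_mulCfg hη hL k h₀ h₁ hα₀ hα₀c hα₂ hα₂c hu h7 h9 hA hG hDDA Ω)

omit [NormOneClass 𝔸] [CompleteSpace 𝔸] in
/-- (1.139) in print's admitted case «Ω_j = T_η for j = 0, 1, …, l» (p. 77) at `l = k`: from
`U₀ ∈ 𝔄_k({T_η, …, T_η}, α₀)` the level-`k` conditions (1.7)/(1.9) hold at every plaquette / bond.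
[cite: Balaban1985RegularSpaces, (1.139) p.100 (with p.77, sentence after (1.6))] -/
theorem forall_of_inAk_univ {η : ℝ} {L k : ℕ} {α₀ : ℝ} {U₀ : Site d → Fin d → 𝔸ˣ}
    (h : InAk L k η α₀ (fun _ => Set.univ) U₀) :
    (∀ (y : Site d) (κ ν : Fin d), κ ≠ ν → ‖plaqF U₀ κ ν y - 1‖ < α₀ * (((L : ℝ) ^ k)⁻¹) ^ 2) ∧
      ∀ (y : Site d) (κ : Fin d), ‖covDiv η U₀ κ y‖ < α₀ * (((L : ℝ) ^ k)⁻¹) ^ 2 * ((L : ℝ) ^ k * η)⁻¹ :=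
  ⟨fun y κ ν hκν => (h k le_rfl).1 y κ ν hκν (Or.inl (Set.mem_univ y)),
    fun y κ => (h k le_rfl).2 y κ (Or.inl (Set.mem_univ y))⟩

/-- **(1.144), `𝔄_k`-clause, with (1.139) entered literally** as `U₀ ∈ 𝔄_k({T_η, …, T_η}, α₀)` (print's admitted
case «Ω_j = T_η», p. 77): then `(U₁U₀)^u ∈ 𝔄_k({Ω_j}, α₀ + 3α₂)` for every family `{Ω_j}` and every `U1`-valued
`u`, under (1.140) at level `k` on all bonds and `0 ≤ α₀, α₂ ≤ 1/(80d)`.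
[cite: Balaban1985RegularSpaces, Prop. 7 (1.144) p.100] -/
theorem inAk_mulCfg_of_inAk_univ {η : ℝ} (hη : 0 < η) {L : ℕ} (hL : 1 ≤ L) (k : ℕ)
    {U₀ : Site d → Fin d → 𝔸ˣ} (h₀ : ∀ y κ, U₀ y κ ∈ U1 𝔸) {A : Site d → Fin d → 𝔸}
    (h₁ : ∀ y κ, expCfg (iEta η A) y κ ∈ U1 𝔸) {α₀ α₂ : ℝ} (hα₀ : 0 ≤ α₀) (hα₀c : α₀ ≤ 1 / (80 * d))
    (hα₂ : 0 ≤ α₂) (hα₂c : α₂ ≤ 1 / (80 * d))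
    (hu : ∀ y κ, ‖(expCfg (iEta η A) y κ : 𝔸) - 1‖ ≤ α₂ * ((L : ℝ) ^ k * η)⁻¹ * η)
    (h139 : InAk L k η α₀ (fun _ => Set.univ) U₀)
    (hA : ∀ y κ, ‖A y κ‖ ≤ α₂ * ((L : ℝ) ^ k * η)⁻¹)
    (hG : ∀ (y : Site d) (κ τ : Fin d), ‖covDerivFwd η U₀ κ (fun z => A z τ) y‖ ≤ α₂ * (((L : ℝ) ^ k * η)⁻¹) ^ 2)
    (hDDA : ∀ (y : Site d) (κ : Fin d), ‖pdiv η U₀ (plaqCovDeriv η U₀ A) κ y‖ ≤ α₂ * (((L : ℝ) ^ k * η)⁻¹) ^ 3)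
    (Ω : ℕ → Set (Site d)) {u : Site d → 𝔸ˣ} (hu1 : ∀ x, u x ∈ U1 𝔸) :
    InAk L k η (α₀ + 3 * α₂) Ω (gaugeAct u (mulCfg (expCfg (iEta η A)) U₀)) :=
  inAk_mulCfg_gaugeAct hη hL k h₀ h₁ hα₀ hα₀c hα₂ hα₂c hu (forall_of_inAk_univ h139).1
    (forall_of_inAk_univ h139).2 hA hG hDDA Ω hu1

end ClassAk

end Literature.MathematicalPhysics.QuantumFieldTheory.Balaban1983to89.B8Ineq1144ClassAk

/-! ## §3. The Hermitian case: `A` self-adjoint in a C⋆-algebra (print: `A` `𝔤`-valued, `𝔤 ⊂ u(N)`, `U₀` unitary) -/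

namespace Literature.MathematicalPhysics.QuantumFieldTheory.Balaban1983to89.B8Ineq1144ClassAk

open B7Prop1Explicit
open B8Lemma1NonAbelian (mulCfg)
open B8Ineq132 (plaqF covDerivFwd covDiv CondAt InAk)
open B8Eq143PlaqExpansion (pdiv)
open B8Eq146AExpansion (expCfg iEta plaqCovDeriv)
open B8Eq155JBound (expCfg_iEta_mem_U1 norm_expCfg_iEta_sub_one_le_of_141)

variable {d : ℕ} {𝔸 : Type*} [CStarAlgebra 𝔸] [Nontrivial 𝔸]

/-- **(1.144), `𝔄_k`-clause, for Hermitian `A`: `U₁U₀ ∈ 𝔄_k({Ω_j}, α₀ + 3α₂)` for every family `{Ω_j}`**,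
from (1.139)/(1.140) at the top level `k` on the whole lattice and `0 ≤ α₀, α₂ ≤ 1/(80d)` (`U₁ = e^{iηA}` unitary,
`|U₁ − 1| ≤ η|A|` discharged). [cite: Balaban1985RegularSpaces, Prop. 7 (1.144) p.100] -/
theorem inAk_mulCfg_hermitian {η : ℝ} (hη : 0 < η) {L : ℕ} (hL : 1 ≤ L) (k : ℕ) {U₀ : Site d → Fin d → 𝔸ˣ}
    (h₀ : ∀ y κ, U₀ y κ ∈ U1 𝔸) {A : Site d → Fin d → 𝔸} (hAh : ∀ y κ, IsSelfAdjoint (A y κ))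
    {α₀ α₂ : ℝ} (hα₀ : 0 ≤ α₀) (hα₀c : α₀ ≤ 1 / (80 * d)) (hα₂ : 0 ≤ α₂) (hα₂c : α₂ ≤ 1 / (80 * d))
    (h7 : ∀ (y : Site d) (κ ν : Fin d), κ ≠ ν → ‖plaqF U₀ κ ν y - 1‖ < α₀ * (((L : ℝ) ^ k)⁻¹) ^ 2)
    (h9 : ∀ (y : Site d) (κ : Fin d), ‖covDiv η U₀ κ y‖ < α₀ * (((L : ℝ) ^ k)⁻¹) ^ 2 * ((L : ℝ) ^ k * η)⁻¹)
    (hA : ∀ y κ, ‖A y κ‖ ≤ α₂ * ((L : ℝ) ^ k * η)⁻¹)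
    (hG : ∀ (y : Site d) (κ τ : Fin d), ‖covDerivFwd η U₀ κ (fun z => A z τ) y‖ ≤ α₂ * (((L : ℝ) ^ k * η)⁻¹) ^ 2)
    (hDDA : ∀ (y : Site d) (κ : Fin d), ‖pdiv η U₀ (plaqCovDeriv η U₀ A) κ y‖ ≤ α₂ * (((L : ℝ) ^ k * η)⁻¹) ^ 3)
    (Ω : ℕ → Set (Site d)) : InAk L k η (α₀ + 3 * α₂) Ω (mulCfg (expCfg (iEta η A)) U₀) :=
  inAk_mulCfg hη hL k h₀ (expCfg_iEta_mem_U1 η hAh) hα₀ hα₀c hα₂ hα₂c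
    (norm_expCfg_iEta_sub_one_le_of_141 hη.le hAh hA) h7 h9 hA hG hDDA Ω

/-- **(1.144) for Hermitian `A`: `U′U₀ = (U₁U₀)^u ∈ 𝔄_k({Ω_j}, α₀ + 3α₂)` for every `U1`-valued gauge
transformation `u`** (in particular print's axial `u`). [cite: Balaban1985RegularSpaces, Prop. 7 (1.144) p.100] -/
theorem inAk_mulCfg_gaugeAct_hermitian {η : ℝ} (hη : 0 < η) {L : ℕ} (hL : 1 ≤ L) (k : ℕ)
    {U₀ : Site d → Fin d → 𝔸ˣ} (h₀ : ∀ y κ, U₀ y κ ∈ U1 𝔸) {A : Site d → Fin d → 𝔸}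
    (hAh : ∀ y κ, IsSelfAdjoint (A y κ)) {α₀ α₂ : ℝ} (hα₀ : 0 ≤ α₀) (hα₀c : α₀ ≤ 1 / (80 * d))
    (hα₂ : 0 ≤ α₂) (hα₂c : α₂ ≤ 1 / (80 * d))
    (h7 : ∀ (y : Site d) (κ ν : Fin d), κ ≠ ν → ‖plaqF U₀ κ ν y - 1‖ < α₀ * (((L : ℝ) ^ k)⁻¹) ^ 2)
    (h9 : ∀ (y : Site d) (κ : Fin d), ‖covDiv η U₀ κ y‖ < α₀ * (((L : ℝ) ^ k)⁻¹) ^ 2 * ((L : ℝ) ^ k * η)⁻¹)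
    (hA : ∀ y κ, ‖A y κ‖ ≤ α₂ * ((L : ℝ) ^ k * η)⁻¹)
    (hG : ∀ (y : Site d) (κ τ : Fin d), ‖covDerivFwd η U₀ κ (fun z => A z τ) y‖ ≤ α₂ * (((L : ℝ) ^ k * η)⁻¹) ^ 2)
    (hDDA : ∀ (y : Site d) (κ : Fin d), ‖pdiv η U₀ (plaqCovDeriv η U₀ A) κ y‖ ≤ α₂ * (((L : ℝ) ^ k * η)⁻¹) ^ 3)
    (Ω : ℕ → Set (Site d)) {u : Site d → 𝔸ˣ} (hu1 : ∀ x, u x ∈ U1 𝔸) :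
    InAk L k η (α₀ + 3 * α₂) Ω (gaugeAct u (mulCfg (expCfg (iEta η A)) U₀)) :=
  inAk_mulCfg_gaugeAct hη hL k h₀ (expCfg_iEta_mem_U1 η hAh) hα₀ hα₀c hα₂ hα₂c
    (norm_expCfg_iEta_sub_one_le_of_141 hη.le hAh hA) h7 h9 hA hG hDDA Ω hu1

/-- **Proposition 7, the `𝔄_k`-clause of (1.144), in the sentence shape of the abstract leaf
`B8SectGH.Prop7PrintedR`** («for α₀, α₂ sufficiently small» = `∃ c > 0, ∀ α₀, α₂ ∈ (0, c]`; here `c = 1/(80d)`,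
`d ≥ 1`) on the `ℤ^d` carriers, `𝔸` a C⋆-algebra, `A` Hermitian, `U₀` with values in `U1 ⊇` the unitaries,
`η > 0`, `L ≥ 1`: if `U₀ ∈ 𝔄_k({T_η, …, T_η}, α₀)` ((1.139), print's admitted case «Ω_j = T_η») and `A` satisfies
the three members of (1.140) at level `k` on all bonds, then `U′U₀ = (U₁U₀)^u ∈ 𝔄_k({Ω_j}, α₀ + 3α₂)` for every
family `{Ω_j}` and every `U1`-valued gauge transformation `u`. [cite: Balaban1985RegularSpaces, Prop. 7 (1.144) p.100] -/
theorem prop7_classAk (hd : 1 ≤ d) {η : ℝ} (hη : 0 < η) {L : ℕ} (hL : 1 ≤ L) (k : ℕ) :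
    ∃ c : ℝ, 0 < c ∧ ∀ α₀ α₂ : ℝ, 0 < α₀ → α₀ ≤ c → 0 < α₂ → α₂ ≤ c →
      ∀ U₀ : Site d → Fin d → 𝔸ˣ, (∀ y κ, U₀ y κ ∈ U1 𝔸) →
        ∀ A : Site d → Fin d → 𝔸, (∀ y κ, IsSelfAdjoint (A y κ)) →
          InAk L k η α₀ (fun _ => Set.univ) U₀ →
          (∀ y κ, ‖A y κ‖ ≤ α₂ * ((L : ℝ) ^ k * η)⁻¹) →
          (∀ (y : Site d) (κ τ : Fin d),
              ‖covDerivFwd η U₀ κ (fun z => A z τ) y‖ ≤ α₂ * (((L : ℝ) ^ k * η)⁻¹) ^ 2) →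
          (∀ (y : Site d) (κ : Fin d),
              ‖pdiv η U₀ (plaqCovDeriv η U₀ A) κ y‖ ≤ α₂ * (((L : ℝ) ^ k * η)⁻¹) ^ 3) →
            ∀ (Ω : ℕ → Set (Site d)) (u : Site d → 𝔸ˣ), (∀ x, u x ∈ U1 𝔸) →
              InAk L k η (α₀ + 3 * α₂) Ω (gaugeAct u (mulCfg (expCfg (iEta η A)) U₀)) := by
  refine ⟨1 / (80 * d), by positivity, ?_⟩
  intro α₀ α₂ hα₀ hα₀c hα₂ hα₂c U₀ h₀ A hAh h139 hA hG hDDA Ω u hu1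
  exact inAk_mulCfg_gaugeAct_hermitian hη hL k h₀ hAh hα₀.le hα₀c hα₂.le hα₂c (forall_of_inAk_univ h139).1
    (forall_of_inAk_univ h139).2 hA hG hDDA Ω hu1

#print axioms condAt_mulCfg
#print axioms inAk_mulCfg_gaugeAct
#print axioms inAk_mulCfg_of_inAk_univ
#print axioms prop7_classAk

end Literature.MathematicalPhysics.QuantumFieldTheory.Balaban1983to89.B8Ineq1144ClassAk

end
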